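import Summits.QuantumFields.YangMills.Theorems.ComplexCouplingChannelComplexStrongCouplingAnchor
import Summits.QuantumFields.YangMills.Theorems.ComplexCouplingChannelFreeEnergyWindowChannelTransportCriterion
import Literature.MathematicalPhysics.QuantumFieldTheory.WilsonFinTorusPartitionComplex
import HarnessLib

/-!
# `ComplexCouplingChannel.FreeEnergyWindowChannel` — line Sketch, stub `stub_reach_of_crux`

Stub Y1 (layer 6: the regime split is LOSSLESS, crux ⇒ REACH) of line `Sketch` for crux `FreeEnergyWindowChannel`
(item `stmt-QuantumFields-18842`, route `ComplexCouplingChannel` of `QuantumFields/YangMills`), lead c3.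

Under the crux, for every admissible `(G, r)` and every threshold `b` some `βs ≥ b` is joined to `0` by an open
connected set `D ⊆ ℂ` on which the symmetric-torus Wilson partition functions
`Z_P z = wilsonFinTorusPartitionC r.ρ z P P P P`, `P ≥ P₀`, have no zeros.

Proof: the landed `torusZeroFree_of_crux` (crux ⇒ T) gives `β₁`; put `βs := max b β₁` and apply T at `(βs, ρ₀)`,
`ρ₀` the radius of the PROVED strong-coupling anchor `complexStrongCouplingAnchor_proof` (zero-free disc `‖z‖ < ρ₀`
for `P ≥ 1`): an open connected zero-free `D ∋ βs` through a real `x`, `|x| < ρ₀`.  The union `D ∪ ball 0 ρ₀` is open,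
connected (the two pieces meet at `x`), contains `0` and `βs`, and is zero-free for `P ≥ max P₀ 1`.

Nothing here asserts a Theses statement; the file proves `crux → consequence` and supports the crux item.
-/

set_option autoImplicit false

noncomputable section

open Literature.MathematicalPhysics.QuantumFieldTheory

namespace Summit.QuantumFields.YangMills.Theorems.FreeEnergyWindowChannel

/-- **Registered stub `stub_reach_of_crux` of line `Sketch` (layer 6, lead c3): crux ⇒ REACH.**  Under
`FreeEnergyWindowChannel`, for every admissible `(G, r)` and every threshold `b` some `βs ≥ b` is joined to `0` by an
open connected channel on which `Z_P`, `P ≥ P₀`, has no zeros: the crux's zero-free channel at `(max b β₁, ρ₀)`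
(`torusZeroFree_of_crux`) united with the anchor's zero-free disc `ball 0 ρ₀` (`complexStrongCouplingAnchor_proof`),
which meet at the real point `x`. [folklore] -/
theorem stub_reach_of_crux :
    Summit.QuantumFields.YangMills.Theses.ComplexCouplingChannel.FreeEnergyWindowChannel →
    ∀ (G : Type) [Group G] [TopologicalSpace G] [IsTopologicalGroup G] [CompactSpace G] [MeasurableSpace G] [BorelSpace G], Literature.MathematicalPhysics.QuantumFieldTheory.IsCompactSimpleLieGroup G → ∀ r : Literature.MathematicalPhysics.QuantumFieldTheory.LatticeRep G,
    ∀ b : ℝ, ∃ βs : ℝ, b ≤ βs ∧ ∃ D : Set ℂ, IsOpen D ∧ IsConnected D ∧ (0 : ℂ) ∈ D ∧ ((βs : ℝ) : ℂ) ∈ D ∧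
      ∃ P₀ : ℕ, ∀ P : ℕ, P₀ ≤ P → ∀ z ∈ D,
        Literature.MathematicalPhysics.QuantumFieldTheory.wilsonFinTorusPartitionC r.ρ z P P P P ≠ 0 := by
  intro h G _ _ _ _ _ _ hG r b
  -- the proved anchor (torus clause): zero-free disc `‖z‖ < ρ₀` for `P ≥ 1`
  obtain ⟨ρ₀, hρ₀, c, -, -, fA, -, C, hA⟩ :=
    Summit.QuantumFields.YangMills.Theorems.complexStrongCouplingAnchor_proof G hG r
  have hA' : ∀ P : ℕ, 1 ≤ P → ∀ z : ℂ, ‖z‖ < ρ₀ → wilsonFinTorusPartitionC r.ρ z P P P P ≠ 0 ∧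
      |Real.log ‖wilsonFinTorusPartitionC r.ρ z P P P P‖ + (P : ℝ) ^ 4 * (fA z).re| ≤
        C * (P : ℝ) ^ 4 * Real.exp (-(c * P)) :=
    fun P hP z hz => hA P hP z hz
  -- the crux's zero-free channel at `(max b β₁, ρ₀)`
  obtain ⟨β₁, hβ₁⟩ := torusZeroFree_of_crux h G hG r
  obtain ⟨D, hDo, hDc, hβD, ⟨x, hxρ, hxD⟩, P₀, hZ⟩ := hβ₁ (max b β₁) (le_max_right _ _) ρ₀ hρ₀
  have hxB : (x : ℂ) ∈ Metric.ball (0 : ℂ) ρ₀ := by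
    rw [mem_ball_zero_iff, Complex.norm_real, Real.norm_eq_abs]
    exact hxρ
  refine ⟨max b β₁, le_max_left _ _, D ∪ Metric.ball (0 : ℂ) ρ₀, hDo.union Metric.isOpen_ball,
    hDc.union ⟨(x : ℂ), hxD, hxB⟩ (Metric.isConnected_ball hρ₀), Or.inr (Metric.mem_ball_self hρ₀), Or.inl hβD,
    max P₀ 1, fun P hP z hz => ?_⟩
  rcases hz with hz | hz
  · exact hZ P (le_of_max_le_left hP) z hz
  · exact (hA' P (le_of_max_le_right hP) z (mem_ball_zero_iff.1 hz)).1

end Summit.QuantumFields.YangMills.Theorems.FreeEnergyWindowChannel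

end
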